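import Summits.QuantumFields.BalabanUV.Beta.GAN24.TableDressingDefect
import Summits.QuantumFields.BalabanUV.Beta.GAN24.Lin4Additive
import Summits.QuantumFields.BalabanUV.Beta.GAN24.Lin4ZeroMode
import Summits.QuantumFields.BalabanUV.Beta.GAN24.TransportStepLipschitz
import Summits.QuantumFields.BalabanUV.Beta.GAN24.T2DevShapes
import Summits.QuantumFields.BalabanUV.Beta.GAN24.WSlotCauchyOfShapes
import Summits.QuantumFields.BalabanUV.Beta.GAN24.WSlotForcingZeroMode

/-!
# `BalabanUV.Beta.GAN24.T2DevConservationDefectRows` — binder row G-an2-4 / (CONV-C), W-slot CT-W, route «WC-TL» (RULING R-gan24p1-g24-1 ∕ -2), A-0 in DEVIATION FORM: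
# **THE TWO DISPLAYED A-0 ROWS (H) ∕ (H-rate) OF `T2DevConservationEnd` ∕ `T2DevConservationDrift` REDUCED TO ROWS ON THE ORBIT's DRESSING DEFECT `Y_m := (𝔇 − 1) T̃_m`**
# (the OWNER gan24-p1 g24's design `gen24/CT-W-DESIGN-v2.md` §3 ∕ §5: «(H) is (Q) minus the source rows … operator constants for ι_S (leaf-06 ✓), 𝒜^B one step (W3 ✓)»;
# this lineage's INTENT I-leaf01-g63-3, journal l.39345).

NOT IN PRINT; OUR BOOKKEEPING ([folklore] composition BY NAME: leaf-06's `TableDressingDefect.lin4_comb_coDressKBmAt_sub` (`𝒜^E X − 𝒜^B X = 𝒜^B ((𝔇 − 1) X)`), leaf-18's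
`Lin4ZeroMode.locStencil₂_lin4`, leaf-01's `Lin4Additive.lin4_sub`, leaf-03's `TransportStepLipschitz.lin_cauchy`, p2's F4 `T2RecSourceRows.source_rows_three_of_srecAt_rows` ∘ the OWNER's
`SrecAtSlotRowsFinal.exists_hS_hSall_SrecAt_three` (dressed sources), leaf-04's (A)∕(B) `T2UndressedCombShapeEnd.source_rows_three_holds` (undressed sources), road P1's
`KSlotAssembly.convCKWall_holds`; G-an2-4 formalisation swarm, leaf prover `b2b-balaban-gan24-formalise-leaf-01`, gen 63).  HONEST FRAMING (cell contract, verbatim): «discharging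
`BetaPertH` makes Bałaban's UV stability UNCONDITIONAL — a real constructive-QFT result; it is NOT the continuum limit and NOT the Clay problem.»  HONEST DEPENDENCY (verbatim):
«continuum YM on T⁴ ⇐ BetaPertH ∧ nine spine estimates (0/9 proved); BetaPertH ⇐ (D1) ∧ (D4) ∧ CAP+tail; G-an2-4 gates asym, D1 and NE2/3/4.»

## Objects: `T̃_m` the dressed comb tower, `𝒜^B_m := lin4 c₄ (unitK_m (KInvStep Lc m)) Lc`, `b̃_m ∕ b_m` the dressed ∕ undressed-kernel comb sources,
## `h_m := (𝒜^E_m T̃_m − 𝒜^B_m T̃_m) + (b̃_m − b_m)` (the Ledger's letter), `Y_m := (𝔇 − 1) T̃_m` in leaf-06's literal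
## `(fun κ u κ′ u′ ↦ dressKBmAt ρ Lc (coProjBmAtK ρ Lc (fun κ₁ u₁ ↦ coProjBmAtK ρ Lc (T̃_m κ₁ u₁) κ′ u′) κ u)) − T̃_m`.
* §1 (generic `d`, `1 ≤ Lc`, in-block root): **`h_comb_eq_lin4_defect_add`** — `h_m = 𝒜^B_m Y_m + (b̃_m − b_m)` (unconditional identity); generic rate helpers `locStencil₂_add_rate`,
  `locStencil₂_sub_rate`, `exists_lin4_rate`; **`exists_hH_of_defect_rows`** — (Q-D) `∀ m, LocStencil₂ (Y_m) CY δY` ∧ uniform K decay ∧ uniform source shapes ⟹ (H)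
  `∃ Ch δh, 0 < δh ∧ ∀ m, LocStencil₂ (h_m) Ch δh`; **`exists_hHr_of_defect_rows`** — (Q-D) ∧ (Q-D-rate) `∀ m, LocStencil₂ (Y_{m+1} − Y_m) (CY′·θY^m) δY′` ∧ K-slot `Decays` + Cauchy rows
  ∧ source Cauchy rows ⟹ (H-rate) `∃ Ch′ θh δh′, … ∀ m, LocStencil₂ (h_{m+1} − h_m) (Ch′·θh^m) δh′` (split `𝒜^B_{m+1} Y_{m+1} − 𝒜^B_m Y_m = (𝒜^B_{m+1} − 𝒜^B_m) Y_{m+1} + 𝒜^B_m (Y_{m+1} − Y_m)`).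
* §2 = the companion `T2DevConservationDefectThree` (`d = 3`, `cE = Lc⁴`): (Q-D) ∧ (Q-D-rate) ⟹ (H) ∧ (H-rate) with EVERY source row and K row DISCHARGED BY NAME — the two WC-TL
  rows my A-0 ENDs display become exactly the uniform shape and rate of the orbit's dressing defect, the object T-DL (leaf-06 `TableDressingExpansion`) ∕ SLAVE-src (leaf-06) ∕
  leaf-02's ι-WIN ∕ (Q-R) ∕ (Q-L) bound.
(Q-D) ∕ (Q-D-rate) are HYPOTHESES (the located crux (Q-R) ∕ (Q-L) of RULING R-gan24p1-g24-2 lives inside them); asserts NO shape of Bałaban's tables; NOTHING of «T2Shape» ∕ «T2Drift» ∕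
(hW, hWall) ∕ (C) discharged; NOT «W-slot closed»; NEVER «G-an2-4 closed» as (CONV-C); NOT D1, NOT `BetaPertH`, NOT continuum, NOT Clay.  0 cited facts, 0 `def`, 0 `def … : Prop`,
0 sorry.  2026-08-22.
-/

noncomputable section

open Finset
open scoped BigOperators
open Literature.MathematicalPhysics.QuantumFieldTheory
open Literature.MathematicalPhysics.QuantumFieldTheory.Balaban1983to89
open Literature.MathematicalPhysics.QuantumFieldTheory.Balaban1983to89.Beta
open ExpKernelCalculus (MKer Decays BiLoc VertexFamily VertexFamily₂ shiftK Zl)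
open OneStepResolventKernel (Fib LocStencil decays_mono)
open OneStepKernelFamily (KInvStep decays_KInvStep)
open AffineAveraging (box toSite)
open AveragingMixedJetTables (mixFFAt)
open SecondOrderResponse (W2SymOfK cBi)
open BalabanCompositeJets (LocStencil₂)
open BalabanStepJetsSucc (mmRead)
open BalabanStepW2 (K3OfK M2Of)
open Summit.QuantumFields.BalabanUV.Beta.HessKerDressedUnits (unitK unitS decays_unitK)
open Summit.QuantumFields.BalabanUV.Beta.SecondOrderUnits (unitM unitS₂ unitM₂)
open Summit.QuantumFields.BalabanUV.Beta.AxialDressingRooted (coDressKBmAt dressKBmAt coProjBmAtK)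
open Summit.QuantumFields.BalabanUV.Beta.SpineRooted (T2RecOf T2RecAt SpureRecAt M1At)
open Summit.QuantumFields.BalabanUV.Beta.GAN24.CombesThomas (sfStep smStep)
open Summit.QuantumFields.BalabanUV.Beta.GAN24.T2RecursionAffine (lin4)
open Summit.QuantumFields.BalabanUV.Beta.GAN24.BiStencilZeroMode (Tab)
open Summit.QuantumFields.BalabanUV.Beta.GAN24.WSlotForcingZeroMode (locStencil₂_sub)
open Summit.QuantumFields.BalabanUV.Beta.GAN24.WSlotT2OfPieces (locStencil₂_add sup_of_locStencil₂)
open Summit.QuantumFields.BalabanUV.Beta.GAN24.WSlotCauchyOfShapes (locStencil₂_le_mono mul_pow_le_mul_pow)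
open Summit.QuantumFields.BalabanUV.Beta.GAN24.SecondOrderLipschitz (lSand)
open Summit.QuantumFields.BalabanUV.Beta.GAN24.SecondOrderLipschitzBi (lBi)
open Summit.QuantumFields.BalabanUV.Beta.GAN24.TransportStepLipschitz (lin_cauchy)
open Summit.QuantumFields.BalabanUV.Beta.GAN24.Lin4Additive (lin4_sub)
open Summit.QuantumFields.BalabanUV.Beta.GAN24.Lin4ZeroMode (locStencil₂_lin4)
open Summit.QuantumFields.BalabanUV.Beta.GAN24.TableDressingDefect (lin4_comb_coDressKBmAt_sub)
open Summit.QuantumFields.BalabanUV.Beta.GAN24.T2DevShapes (exists_locStencil₂_towers)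

namespace Summit.QuantumFields.BalabanUV.Beta.GAN24.T2DevConservationDefectRows

/-! ## §1 Generic `d`: the identity, rate helpers, (H) and (H-rate) from the defect rows -/

section Generic

variable {d : ℕ} {Lc : ℕ} [NeZero Lc] {r : Fin (d + 1) → ℕ}

/-- NOT IN PRINT; OUR BOOKKEEPING ([folklore] leaf-06's `TableDressingDefect.lin4_comb_coDressKBmAt_sub` at the comb letters, the member's per-level shape by
`T2DevShapes.exists_locStencil₂_towers`).  **THE DEVIATION FORCING THROUGH THE DRESSING DEFECT**: `h_m = 𝒜^B_m ((𝔇 − 1) T̃_m) + (b̃_m − b_m)` — ONE undressed step of the orbit's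
dressing defect plus the source difference; unconditional identity (generic `d`, `1 ≤ Lc`, in-block root, any off-diagonal-agnostic `LocStencil₂` border).  With the OWNER's
`q_m := 𝒜^B_m ((𝔇 − 1) T̃_m) + b̃_m` this is `h_m = q_m − b_m` (design v2 §5). -/
theorem h_comb_eq_lin4_defect_add (hLc : 1 ≤ Lc) (hr : r ∈ box (d + 1) Lc) (cE cVH cΛ cE₂ cB : ℝ) (Tc : Fin 4 → Fin 4 → Fin 4 → Fin 4 → ℝ)
    {vh₂S : Tab d} (hB : ∃ C δ : ℝ, 0 < δ ∧ LocStencil₂ vh₂S C δ) (m : ℕ) :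
    (((lin4 (cE₂ * (Lc : ℝ) ^ (2 * (d + 1))) (unitK (sfStep Lc m) (smStep d Lc m) (coDressKBmAt (toSite r) Lc (KInvStep (d := d) Lc m))) Lc
            (unitS₂ (sfStep Lc m) (smStep d Lc m) (T2RecAt d Lc (toSite r) cE cVH cΛ cE₂ cB Tc vh₂S (mixFFAt (toSite r) Lc) m)) -
          lin4 (cE₂ * (Lc : ℝ) ^ (2 * (d + 1))) (unitK (sfStep Lc m) (smStep d Lc m) (KInvStep (d := d) Lc m)) Lc
            (unitS₂ (sfStep Lc m) (smStep d Lc m) (T2RecAt d Lc (toSite r) cE cVH cΛ cE₂ cB Tc vh₂S (mixFFAt (toSite r) Lc) m))) +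
        ((fun κ u κ' u' => (cE₂ * (Lc : ℝ) ^ (2 * (d + 1))) • mmRead Lc (K3OfK (unitK (sfStep Lc m) (smStep d Lc m) (coDressKBmAt (toSite r) Lc (KInvStep (d := d) Lc m))) Lc
            (unitS (sfStep Lc m) (smStep d Lc m) (SpureRecAt d Lc (toSite r) cE cVH cΛ m)) (unitM (sfStep Lc m) (smStep d Lc m) (M1At d Lc (toSite r) cΛ m))
            (W2SymOfK (unitK (sfStep Lc m) (smStep d Lc m) (coDressKBmAt (toSite r) Lc (KInvStep (d := d) Lc m))) Lc (unitS (sfStep Lc m) (smStep d Lc m) (SpureRecAt d Lc (toSite r) cE cVH cΛ m))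
              (unitM (sfStep Lc m) (smStep d Lc m) (M1At d Lc (toSite r) cΛ m)) 0 (unitM₂ (sfStep Lc m) (smStep d Lc m) (M2Of d Lc (mixFFAt (toSite r) Lc) m))) κ u κ' u')
          + cB • vh₂S κ u κ' u') -
         (fun κ u κ' u' => (cE₂ * (Lc : ℝ) ^ (2 * (d + 1))) • mmRead Lc (K3OfK (unitK (sfStep Lc m) (smStep d Lc m) (KInvStep (d := d) Lc m)) Lc
            (unitS (sfStep Lc m) (smStep d Lc m) (SpureRecAt d Lc (toSite r) cE cVH cΛ m)) (unitM (sfStep Lc m) (smStep d Lc m) (M1At d Lc (toSite r) cΛ m))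
            (W2SymOfK (unitK (sfStep Lc m) (smStep d Lc m) (KInvStep (d := d) Lc m)) Lc (unitS (sfStep Lc m) (smStep d Lc m) (SpureRecAt d Lc (toSite r) cE cVH cΛ m))
              (unitM (sfStep Lc m) (smStep d Lc m) (M1At d Lc (toSite r) cΛ m)) 0 (unitM₂ (sfStep Lc m) (smStep d Lc m) (M2Of d Lc (mixFFAt (toSite r) Lc) m))) κ u κ' u')
          + cB • vh₂S κ u κ' u')))) =
      lin4 (cE₂ * (Lc : ℝ) ^ (2 * (d + 1))) (unitK (sfStep Lc m) (smStep d Lc m) (KInvStep (d := d) Lc m)) Lc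
          ((fun κ u κ' u' => dressKBmAt (toSite r) Lc (coProjBmAtK (toSite r) Lc (fun κ₁ u₁ => coProjBmAtK (toSite r) Lc
            ((unitS₂ (sfStep Lc m) (smStep d Lc m) (T2RecAt d Lc (toSite r) cE cVH cΛ cE₂ cB Tc vh₂S (mixFFAt (toSite r) Lc) m)) κ₁ u₁) κ' u') κ u)) -
          (unitS₂ (sfStep Lc m) (smStep d Lc m) (T2RecAt d Lc (toSite r) cE cVH cΛ cE₂ cB Tc vh₂S (mixFFAt (toSite r) Lc) m))) +
        ((fun κ u κ' u' => (cE₂ * (Lc : ℝ) ^ (2 * (d + 1))) • mmRead Lc (K3OfK (unitK (sfStep Lc m) (smStep d Lc m) (coDressKBmAt (toSite r) Lc (KInvStep (d := d) Lc m))) Lc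
            (unitS (sfStep Lc m) (smStep d Lc m) (SpureRecAt d Lc (toSite r) cE cVH cΛ m)) (unitM (sfStep Lc m) (smStep d Lc m) (M1At d Lc (toSite r) cΛ m))
            (W2SymOfK (unitK (sfStep Lc m) (smStep d Lc m) (coDressKBmAt (toSite r) Lc (KInvStep (d := d) Lc m))) Lc (unitS (sfStep Lc m) (smStep d Lc m) (SpureRecAt d Lc (toSite r) cE cVH cΛ m))
              (unitM (sfStep Lc m) (smStep d Lc m) (M1At d Lc (toSite r) cΛ m)) 0 (unitM₂ (sfStep Lc m) (smStep d Lc m) (M2Of d Lc (mixFFAt (toSite r) Lc) m))) κ u κ' u')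
          + cB • vh₂S κ u κ' u') -
         (fun κ u κ' u' => (cE₂ * (Lc : ℝ) ^ (2 * (d + 1))) • mmRead Lc (K3OfK (unitK (sfStep Lc m) (smStep d Lc m) (KInvStep (d := d) Lc m)) Lc
            (unitS (sfStep Lc m) (smStep d Lc m) (SpureRecAt d Lc (toSite r) cE cVH cΛ m)) (unitM (sfStep Lc m) (smStep d Lc m) (M1At d Lc (toSite r) cΛ m))
            (W2SymOfK (unitK (sfStep Lc m) (smStep d Lc m) (KInvStep (d := d) Lc m)) Lc (unitS (sfStep Lc m) (smStep d Lc m) (SpureRecAt d Lc (toSite r) cE cVH cΛ m))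
              (unitM (sfStep Lc m) (smStep d Lc m) (M1At d Lc (toSite r) cΛ m)) 0 (unitM₂ (sfStep Lc m) (smStep d Lc m) (M2Of d Lc (mixFFAt (toSite r) Lc) m))) κ u κ' u')
          + cB • vh₂S κ u κ' u')) := by
  obtain ⟨C, C', δ, hδ, hE, -⟩ := exists_locStencil₂_towers hLc hr cE cVH cΛ cE₂ cB Tc hB m
  rw [lin4_comb_coDressKBmAt_sub hr m hE hδ]

omit [NeZero Lc] in
/-- [folklore] Two geometric `LocStencil₂` rows merge under `+` at `max` of the rates and `min` of the decays. -/
theorem locStencil₂_add_rate {A B : Tab d} {C₁ θ₁ δ₁ C₂ θ₂ δ₂ : ℝ} {m : ℕ} (hA : LocStencil₂ A (C₁ * θ₁ ^ m) δ₁) (hB : LocStencil₂ B (C₂ * θ₂ ^ m) δ₂)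
    (hC₁ : 0 ≤ C₁) (hC₂ : 0 ≤ C₂) (hθ₁ : 0 ≤ θ₁) (hθ₂ : 0 ≤ θ₂) :
    LocStencil₂ (A + B) ((C₁ + C₂) * (max θ₁ θ₂) ^ m) (min δ₁ δ₂) := by
  have h1 := locStencil₂_le_mono hA (mul_pow_le_mul_pow hC₁ hθ₁ (le_max_left θ₁ θ₂) m) (min_le_left δ₁ δ₂)
  have h2 := locStencil₂_le_mono hB (mul_pow_le_mul_pow hC₂ hθ₂ (le_max_right θ₁ θ₂) m) (min_le_right δ₁ δ₂)
  have h := locStencil₂_add h1 h2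
  rw [← add_mul] at h
  exact h

omit [NeZero Lc] in
/-- [folklore] Two geometric `LocStencil₂` rows merge under `−` at `max` of the rates and `min` of the decays. -/
theorem locStencil₂_sub_rate {A B : Tab d} {C₁ θ₁ δ₁ C₂ θ₂ δ₂ : ℝ} {m : ℕ} (hA : LocStencil₂ A (C₁ * θ₁ ^ m) δ₁) (hB : LocStencil₂ B (C₂ * θ₂ ^ m) δ₂)
    (hC₁ : 0 ≤ C₁) (hC₂ : 0 ≤ C₂) (hθ₁ : 0 ≤ θ₁) (hθ₂ : 0 ≤ θ₂) :
    LocStencil₂ (A - B) ((C₁ + C₂) * (max θ₁ θ₂) ^ m) (min δ₁ δ₂) := by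
  have h1 := locStencil₂_le_mono hA (mul_pow_le_mul_pow hC₁ hθ₁ (le_max_left θ₁ θ₂) m) (min_le_left δ₁ δ₂)
  have h2 := locStencil₂_le_mono hB (mul_pow_le_mul_pow hC₂ hθ₂ (le_max_right θ₁ θ₂) m) (min_le_right δ₁ δ₂)
  have h := locStencil₂_sub h1 h2
  rw [abs_neg, abs_one, one_mul, ← add_mul] at h
  exact h

/-- [folklore] **ONE UNDRESSED STEP OF A GEOMETRIC FAMILY IS GEOMETRIC** (leaf-18's `Lin4ZeroMode.locStencil₂_lin4` with a uniformly decaying kernel family; the constant is linear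
in the input constant): `LocStencil₂ (Z_m) (CZ·θ^m) δZ` for all `m` ⟹ `∃ L, 0 ≤ L ∧ ∀ m, LocStencil₂ (𝒜^B_m Z_m) (L·θ^m) (min δK δZ ∕ 128)`. -/
theorem exists_lin4_rate (hLc : 1 ≤ Lc) (c : ℝ) (Z : ℕ → Tab d) {CK δK CZ θ δZ : ℝ}
    (hK : ∀ j : ℕ, Decays (unitK (sfStep Lc j) (smStep d Lc j) (KInvStep (d := d) Lc j)) CK δK) (hδK : 0 < δK)
    (hZ : ∀ m : ℕ, LocStencil₂ (Z m) (CZ * θ ^ m) δZ) (hδZ : 0 < δZ) :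
    ∃ L : ℝ, 0 ≤ L ∧ ∀ m : ℕ, LocStencil₂ (lin4 c (unitK (sfStep Lc m) (smStep d Lc m) (KInvStep (d := d) Lc m)) Lc (Z m)) (L * θ ^ m) (min δK δZ / 128) := by
  have hCK : 0 ≤ CK := (hK 0).nonneg (Sum.inl 0)
  have hCZ : 0 ≤ CZ := by have h := (hZ 0).nonneg; simpa using h
  obtain ⟨L, hL_def⟩ : ∃ L : ℝ, L = |c| * ((Fintype.card (Fib d) : ℝ) * ((Fintype.card (Fib d) : ℝ) * (CK * cBi d CK 1 (min δK δZ)) *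
      Zl (d + 1) (min δK δZ / 32 / 2) * CK) * Zl (d + 1) (min δK δZ / 32 / 4) * CZ) := ⟨_, rfl⟩
  have h : ∀ m : ℕ, LocStencil₂ (lin4 c (unitK (sfStep Lc m) (smStep d Lc m) (KInvStep (d := d) Lc m)) Lc (Z m)) (L * θ ^ m) (min δK δZ / 128) := fun m =>
    locStencil₂_le_mono (locStencil₂_lin4 (hK m) hCK hδK hLc c (hZ m) hδZ) (le_of_eq (by rw [hL_def]; ring)) le_rfl
  exact ⟨L, by have h0 := (h 0).nonneg; simpa using h0, h⟩

/-- [folklore] **ONE UNDRESSED STEP OF A UNIFORMLY SHAPED FAMILY IS UNIFORMLY SHAPED** (leaf-18's `Lin4ZeroMode.locStencil₂_lin4`, uniformly decaying kernel family):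
`LocStencil₂ (Z_m) CZ δZ` for all `m` ⟹ `∃ L, 0 ≤ L ∧ ∀ m, LocStencil₂ (𝒜^B_m Z_m) L (min δK δZ ∕ 128)`. -/
theorem exists_lin4_shape (hLc : 1 ≤ Lc) (c : ℝ) (Z : ℕ → Tab d) {CK δK CZ δZ : ℝ}
    (hK : ∀ j : ℕ, Decays (unitK (sfStep Lc j) (smStep d Lc j) (KInvStep (d := d) Lc j)) CK δK) (hδK : 0 < δK)
    (hZ : ∀ m : ℕ, LocStencil₂ (Z m) CZ δZ) (hδZ : 0 < δZ) :
    ∃ L : ℝ, 0 ≤ L ∧ ∀ m : ℕ, LocStencil₂ (lin4 c (unitK (sfStep Lc m) (smStep d Lc m) (KInvStep (d := d) Lc m)) Lc (Z m)) L (min δK δZ / 128) := by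
  have hCK : 0 ≤ CK := (hK 0).nonneg (Sum.inl 0)
  have h : ∀ m : ℕ, LocStencil₂ (lin4 c (unitK (sfStep Lc m) (smStep d Lc m) (KInvStep (d := d) Lc m)) Lc (Z m)) (|c| * ((Fintype.card (Fib d) : ℝ) * ((Fintype.card (Fib d) : ℝ) * (CK * cBi d CK 1 (min δK δZ)) *
      Zl (d + 1) (min δK δZ / 32 / 2) * CK) * Zl (d + 1) (min δK δZ / 32 / 4) * CZ)) (min δK δZ / 128) := fun m =>
    locStencil₂_lin4 (hK m) hCK hδK hLc c (hZ m) hδZ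
  exact ⟨_, (h 0).nonneg, h⟩

/-- NOT IN PRINT; OUR BOOKKEEPING ([folklore] §1 `h_comb_eq_lin4_defect_add` + `Lin4ZeroMode.locStencil₂_lin4` + `locStencil₂_sub ∕ _add`).  **(H) FROM THE DEFECT's UNIFORM SHAPE**
(generic `d`, `1 ≤ Lc`, in-block root): if the step kernels decay uniformly (`CK, δK`), the orbit's dressing defect is uniformly `LocStencil₂ CY δY` — ROW (Q-D) — and the dressed ∕
undressed comb sources are uniformly `LocStencil₂` at a common rate `δb`, then `∃ Ch δh, 0 < δh ∧ ∀ m, LocStencil₂ (h_m) Ch δh` — the (H) binder of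
`T2DevConservationEnd.t2Shape_T2RecAt_three_of_U_C_H` ∕ `T2DevConservationDrift`. -/
theorem exists_hH_of_defect_rows (hLc : 1 ≤ Lc) (hr : r ∈ box (d + 1) Lc) (cE cVH cΛ cE₂ cB : ℝ) (Tc : Fin 4 → Fin 4 → Fin 4 → Fin 4 → ℝ)
    {vh₂S : Tab d} (hB : ∃ C δ : ℝ, 0 < δ ∧ LocStencil₂ vh₂S C δ) {CK δK CY δY CbE CbB δb : ℝ}
    (hK : ∀ j : ℕ, Decays (unitK (sfStep Lc j) (smStep d Lc j) (KInvStep (d := d) Lc j)) CK δK) (hδK : 0 < δK)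
    (hY : ∀ m : ℕ, LocStencil₂ ((fun κ u κ' u' => dressKBmAt (toSite r) Lc (coProjBmAtK (toSite r) Lc (fun κ₁ u₁ => coProjBmAtK (toSite r) Lc
            ((unitS₂ (sfStep Lc m) (smStep d Lc m) (T2RecAt d Lc (toSite r) cE cVH cΛ cE₂ cB Tc vh₂S (mixFFAt (toSite r) Lc) m)) κ₁ u₁) κ' u') κ u)) -
          (unitS₂ (sfStep Lc m) (smStep d Lc m) (T2RecAt d Lc (toSite r) cE cVH cΛ cE₂ cB Tc vh₂S (mixFFAt (toSite r) Lc) m))) CY δY) (hδY : 0 < δY)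
    (hbE : ∀ m : ℕ, LocStencil₂ (fun κ u κ' u' => (cE₂ * (Lc : ℝ) ^ (2 * (d + 1))) • mmRead Lc (K3OfK (unitK (sfStep Lc m) (smStep d Lc m) (coDressKBmAt (toSite r) Lc (KInvStep (d := d) Lc m))) Lc
            (unitS (sfStep Lc m) (smStep d Lc m) (SpureRecAt d Lc (toSite r) cE cVH cΛ m)) (unitM (sfStep Lc m) (smStep d Lc m) (M1At d Lc (toSite r) cΛ m))
            (W2SymOfK (unitK (sfStep Lc m) (smStep d Lc m) (coDressKBmAt (toSite r) Lc (KInvStep (d := d) Lc m))) Lc (unitS (sfStep Lc m) (smStep d Lc m) (SpureRecAt d Lc (toSite r) cE cVH cΛ m))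
              (unitM (sfStep Lc m) (smStep d Lc m) (M1At d Lc (toSite r) cΛ m)) 0 (unitM₂ (sfStep Lc m) (smStep d Lc m) (M2Of d Lc (mixFFAt (toSite r) Lc) m))) κ u κ' u')
          + cB • vh₂S κ u κ' u') CbE δb)
    (hbB : ∀ m : ℕ, LocStencil₂ (fun κ u κ' u' => (cE₂ * (Lc : ℝ) ^ (2 * (d + 1))) • mmRead Lc (K3OfK (unitK (sfStep Lc m) (smStep d Lc m) (KInvStep (d := d) Lc m)) Lc
            (unitS (sfStep Lc m) (smStep d Lc m) (SpureRecAt d Lc (toSite r) cE cVH cΛ m)) (unitM (sfStep Lc m) (smStep d Lc m) (M1At d Lc (toSite r) cΛ m))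
            (W2SymOfK (unitK (sfStep Lc m) (smStep d Lc m) (KInvStep (d := d) Lc m)) Lc (unitS (sfStep Lc m) (smStep d Lc m) (SpureRecAt d Lc (toSite r) cE cVH cΛ m))
              (unitM (sfStep Lc m) (smStep d Lc m) (M1At d Lc (toSite r) cΛ m)) 0 (unitM₂ (sfStep Lc m) (smStep d Lc m) (M2Of d Lc (mixFFAt (toSite r) Lc) m))) κ u κ' u')
          + cB • vh₂S κ u κ' u') CbB δb) (hδb : 0 < δb) :
    ∃ Ch δh : ℝ, 0 < δh ∧ ∀ m : ℕ, LocStencil₂ (((lin4 (cE₂ * (Lc : ℝ) ^ (2 * (d + 1))) (unitK (sfStep Lc m) (smStep d Lc m) (coDressKBmAt (toSite r) Lc (KInvStep (d := d) Lc m))) Lc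
            (unitS₂ (sfStep Lc m) (smStep d Lc m) (T2RecAt d Lc (toSite r) cE cVH cΛ cE₂ cB Tc vh₂S (mixFFAt (toSite r) Lc) m)) -
          lin4 (cE₂ * (Lc : ℝ) ^ (2 * (d + 1))) (unitK (sfStep Lc m) (smStep d Lc m) (KInvStep (d := d) Lc m)) Lc
            (unitS₂ (sfStep Lc m) (smStep d Lc m) (T2RecAt d Lc (toSite r) cE cVH cΛ cE₂ cB Tc vh₂S (mixFFAt (toSite r) Lc) m))) +
        ((fun κ u κ' u' => (cE₂ * (Lc : ℝ) ^ (2 * (d + 1))) • mmRead Lc (K3OfK (unitK (sfStep Lc m) (smStep d Lc m) (coDressKBmAt (toSite r) Lc (KInvStep (d := d) Lc m))) Lc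
            (unitS (sfStep Lc m) (smStep d Lc m) (SpureRecAt d Lc (toSite r) cE cVH cΛ m)) (unitM (sfStep Lc m) (smStep d Lc m) (M1At d Lc (toSite r) cΛ m))
            (W2SymOfK (unitK (sfStep Lc m) (smStep d Lc m) (coDressKBmAt (toSite r) Lc (KInvStep (d := d) Lc m))) Lc (unitS (sfStep Lc m) (smStep d Lc m) (SpureRecAt d Lc (toSite r) cE cVH cΛ m))
              (unitM (sfStep Lc m) (smStep d Lc m) (M1At d Lc (toSite r) cΛ m)) 0 (unitM₂ (sfStep Lc m) (smStep d Lc m) (M2Of d Lc (mixFFAt (toSite r) Lc) m))) κ u κ' u')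
          + cB • vh₂S κ u κ' u') -
         (fun κ u κ' u' => (cE₂ * (Lc : ℝ) ^ (2 * (d + 1))) • mmRead Lc (K3OfK (unitK (sfStep Lc m) (smStep d Lc m) (KInvStep (d := d) Lc m)) Lc
            (unitS (sfStep Lc m) (smStep d Lc m) (SpureRecAt d Lc (toSite r) cE cVH cΛ m)) (unitM (sfStep Lc m) (smStep d Lc m) (M1At d Lc (toSite r) cΛ m))
            (W2SymOfK (unitK (sfStep Lc m) (smStep d Lc m) (KInvStep (d := d) Lc m)) Lc (unitS (sfStep Lc m) (smStep d Lc m) (SpureRecAt d Lc (toSite r) cE cVH cΛ m))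
              (unitM (sfStep Lc m) (smStep d Lc m) (M1At d Lc (toSite r) cΛ m)) 0 (unitM₂ (sfStep Lc m) (smStep d Lc m) (M2Of d Lc (mixFFAt (toSite r) Lc) m))) κ u κ' u')
          + cB • vh₂S κ u κ' u')))) Ch δh := by
  obtain ⟨L, -, hAY⟩ := exists_lin4_shape hLc (cE₂ * (Lc : ℝ) ^ (2 * (d + 1)))
    (fun m => ((fun κ u κ' u' => dressKBmAt (toSite r) Lc (coProjBmAtK (toSite r) Lc (fun κ₁ u₁ => coProjBmAtK (toSite r) Lc
            ((unitS₂ (sfStep Lc m) (smStep d Lc m) (T2RecAt d Lc (toSite r) cE cVH cΛ cE₂ cB Tc vh₂S (mixFFAt (toSite r) Lc) m)) κ₁ u₁) κ' u') κ u)) -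
          (unitS₂ (sfStep Lc m) (smStep d Lc m) (T2RecAt d Lc (toSite r) cE cVH cΛ cE₂ cB Tc vh₂S (mixFFAt (toSite r) Lc) m)))) hK hδK hY hδY
  refine ⟨L + (CbE + |(-1 : ℝ)| * CbB), min (min δK δY / 128) δb, lt_min (by positivity) hδb, fun m => ?_⟩
  rw [h_comb_eq_lin4_defect_add hLc hr cE cVH cΛ cE₂ cB Tc hB m]
  exact locStencil₂_add ((hAY m).mono (min_le_left _ _)) ((locStencil₂_sub (hbE m) (hbB m)).mono (min_le_right _ _))

/-- NOT IN PRINT; OUR BOOKKEEPING ([folklore] §1 `h_comb_eq_lin4_defect_add` at `m, m+1`, `Lin4Additive.lin4_sub`, the split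
`𝒜^B_{m+1} Y_{m+1} − 𝒜^B_m Y_m = (𝒜^B_{m+1} − 𝒜^B_m) Y_{m+1} + 𝒜^B_m (Y_{m+1} − Y_m)`, leaf-03's `TransportStepLipschitz.lin_cauchy` (`k := m, j := 1`), §1 `exists_lin4_rate`, the
rate helpers).  **(H-rate) FROM THE DEFECT's SHAPE AND RATE** (generic `d`, `1 ≤ Lc`, in-block root): K-slot `Decays` + Cauchy rows (`0 ≤ θK < 1`), ROW (Q-D) `∀ m, LocStencil₂ (Y_m) CY δY`,
ROW (Q-D-rate) `∀ m, LocStencil₂ (Y_{m+1} − Y_m) (CY′·θY^m) δY′` (`0 ≤ θY < 1`), and the dressed ∕ undressed source Cauchy rows ⟹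
`∃ Ch′ θh δh′, 0 ≤ Ch′ ∧ 0 ≤ θh ∧ θh < 1 ∧ 0 < δh′ ∧ ∀ m, LocStencil₂ (h_{m+1} − h_m) (Ch′·θh^m) δh′` — the (H-rate) binder of `T2DevConservationDrift`. -/
theorem exists_hHr_of_defect_rows (hLc : 1 ≤ Lc) (hr : r ∈ box (d + 1) Lc) (cE cVH cΛ cE₂ cB : ℝ) (Tc : Fin 4 → Fin 4 → Fin 4 → Fin 4 → ℝ)
    {vh₂S : Tab d} (hB : ∃ C δ : ℝ, 0 < δ ∧ LocStencil₂ vh₂S C δ) {CK δK cK θK CY δY CY' θY δY' cbE θbE δbE cbB θbB δbB : ℝ}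
    (hK : ∀ j : ℕ, Decays (unitK (sfStep Lc j) (smStep d Lc j) (KInvStep (d := d) Lc j)) CK δK)
    (hKc : ∀ k j : ℕ, Decays ((unitK (sfStep Lc (k + j)) (smStep d Lc (k + j)) (KInvStep (d := d) Lc (k + j))) - (unitK (sfStep Lc k) (smStep d Lc k) (KInvStep (d := d) Lc k))) (cK * θK ^ k) δK)
    (hδK : 0 < δK) (hθK0 : 0 ≤ θK) (hθK1 : θK < 1)
    (hY : ∀ m : ℕ, LocStencil₂ ((fun κ u κ' u' => dressKBmAt (toSite r) Lc (coProjBmAtK (toSite r) Lc (fun κ₁ u₁ => coProjBmAtK (toSite r) Lc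
            ((unitS₂ (sfStep Lc m) (smStep d Lc m) (T2RecAt d Lc (toSite r) cE cVH cΛ cE₂ cB Tc vh₂S (mixFFAt (toSite r) Lc) m)) κ₁ u₁) κ' u') κ u)) -
          (unitS₂ (sfStep Lc m) (smStep d Lc m) (T2RecAt d Lc (toSite r) cE cVH cΛ cE₂ cB Tc vh₂S (mixFFAt (toSite r) Lc) m))) CY δY) (hδY : 0 < δY)
    (hYr : ∀ m : ℕ, LocStencil₂ (((fun κ u κ' u' => dressKBmAt (toSite r) Lc (coProjBmAtK (toSite r) Lc (fun κ₁ u₁ => coProjBmAtK (toSite r) Lc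
            ((unitS₂ (sfStep Lc (m + 1)) (smStep d Lc (m + 1)) (T2RecAt d Lc (toSite r) cE cVH cΛ cE₂ cB Tc vh₂S (mixFFAt (toSite r) Lc) (m + 1))) κ₁ u₁) κ' u') κ u)) -
          (unitS₂ (sfStep Lc (m + 1)) (smStep d Lc (m + 1)) (T2RecAt d Lc (toSite r) cE cVH cΛ cE₂ cB Tc vh₂S (mixFFAt (toSite r) Lc) (m + 1)))) -
      ((fun κ u κ' u' => dressKBmAt (toSite r) Lc (coProjBmAtK (toSite r) Lc (fun κ₁ u₁ => coProjBmAtK (toSite r) Lc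
            ((unitS₂ (sfStep Lc m) (smStep d Lc m) (T2RecAt d Lc (toSite r) cE cVH cΛ cE₂ cB Tc vh₂S (mixFFAt (toSite r) Lc) m)) κ₁ u₁) κ' u') κ u)) -
          (unitS₂ (sfStep Lc m) (smStep d Lc m) (T2RecAt d Lc (toSite r) cE cVH cΛ cE₂ cB Tc vh₂S (mixFFAt (toSite r) Lc) m)))) (CY' * θY ^ m) δY') (hθY0 : 0 ≤ θY) (hθY1 : θY < 1) (hδY' : 0 < δY')
    (hbEr : ∀ m : ℕ, LocStencil₂ ((fun κ u κ' u' => (cE₂ * (Lc : ℝ) ^ (2 * (d + 1))) • mmRead Lc (K3OfK (unitK (sfStep Lc (m + 1)) (smStep d Lc (m + 1)) (coDressKBmAt (toSite r) Lc (KInvStep (d := d) Lc (m + 1)))) Lc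
            (unitS (sfStep Lc (m + 1)) (smStep d Lc (m + 1)) (SpureRecAt d Lc (toSite r) cE cVH cΛ (m + 1))) (unitM (sfStep Lc (m + 1)) (smStep d Lc (m + 1)) (M1At d Lc (toSite r) cΛ (m + 1)))
            (W2SymOfK (unitK (sfStep Lc (m + 1)) (smStep d Lc (m + 1)) (coDressKBmAt (toSite r) Lc (KInvStep (d := d) Lc (m + 1)))) Lc (unitS (sfStep Lc (m + 1)) (smStep d Lc (m + 1)) (SpureRecAt d Lc (toSite r) cE cVH cΛ (m + 1)))
              (unitM (sfStep Lc (m + 1)) (smStep d Lc (m + 1)) (M1At d Lc (toSite r) cΛ (m + 1))) 0 (unitM₂ (sfStep Lc (m + 1)) (smStep d Lc (m + 1)) (M2Of d Lc (mixFFAt (toSite r) Lc) (m + 1)))) κ u κ' u')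
          + cB • vh₂S κ u κ' u') -
      (fun κ u κ' u' => (cE₂ * (Lc : ℝ) ^ (2 * (d + 1))) • mmRead Lc (K3OfK (unitK (sfStep Lc m) (smStep d Lc m) (coDressKBmAt (toSite r) Lc (KInvStep (d := d) Lc m))) Lc
            (unitS (sfStep Lc m) (smStep d Lc m) (SpureRecAt d Lc (toSite r) cE cVH cΛ m)) (unitM (sfStep Lc m) (smStep d Lc m) (M1At d Lc (toSite r) cΛ m))
            (W2SymOfK (unitK (sfStep Lc m) (smStep d Lc m) (coDressKBmAt (toSite r) Lc (KInvStep (d := d) Lc m))) Lc (unitS (sfStep Lc m) (smStep d Lc m) (SpureRecAt d Lc (toSite r) cE cVH cΛ m))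
              (unitM (sfStep Lc m) (smStep d Lc m) (M1At d Lc (toSite r) cΛ m)) 0 (unitM₂ (sfStep Lc m) (smStep d Lc m) (M2Of d Lc (mixFFAt (toSite r) Lc) m))) κ u κ' u')
          + cB • vh₂S κ u κ' u')) (cbE * θbE ^ m) δbE) (hθbE0 : 0 ≤ θbE) (hθbE1 : θbE < 1) (hδbE : 0 < δbE)
    (hbBr : ∀ m : ℕ, LocStencil₂ ((fun κ u κ' u' => (cE₂ * (Lc : ℝ) ^ (2 * (d + 1))) • mmRead Lc (K3OfK (unitK (sfStep Lc (m + 1)) (smStep d Lc (m + 1)) (KInvStep (d := d) Lc (m + 1))) Lc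
            (unitS (sfStep Lc (m + 1)) (smStep d Lc (m + 1)) (SpureRecAt d Lc (toSite r) cE cVH cΛ (m + 1))) (unitM (sfStep Lc (m + 1)) (smStep d Lc (m + 1)) (M1At d Lc (toSite r) cΛ (m + 1)))
            (W2SymOfK (unitK (sfStep Lc (m + 1)) (smStep d Lc (m + 1)) (KInvStep (d := d) Lc (m + 1))) Lc (unitS (sfStep Lc (m + 1)) (smStep d Lc (m + 1)) (SpureRecAt d Lc (toSite r) cE cVH cΛ (m + 1)))
              (unitM (sfStep Lc (m + 1)) (smStep d Lc (m + 1)) (M1At d Lc (toSite r) cΛ (m + 1))) 0 (unitM₂ (sfStep Lc (m + 1)) (smStep d Lc (m + 1)) (M2Of d Lc (mixFFAt (toSite r) Lc) (m + 1)))) κ u κ' u')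
          + cB • vh₂S κ u κ' u') -
      (fun κ u κ' u' => (cE₂ * (Lc : ℝ) ^ (2 * (d + 1))) • mmRead Lc (K3OfK (unitK (sfStep Lc m) (smStep d Lc m) (KInvStep (d := d) Lc m)) Lc
            (unitS (sfStep Lc m) (smStep d Lc m) (SpureRecAt d Lc (toSite r) cE cVH cΛ m)) (unitM (sfStep Lc m) (smStep d Lc m) (M1At d Lc (toSite r) cΛ m))
            (W2SymOfK (unitK (sfStep Lc m) (smStep d Lc m) (KInvStep (d := d) Lc m)) Lc (unitS (sfStep Lc m) (smStep d Lc m) (SpureRecAt d Lc (toSite r) cE cVH cΛ m))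
              (unitM (sfStep Lc m) (smStep d Lc m) (M1At d Lc (toSite r) cΛ m)) 0 (unitM₂ (sfStep Lc m) (smStep d Lc m) (M2Of d Lc (mixFFAt (toSite r) Lc) m))) κ u κ' u')
          + cB • vh₂S κ u κ' u')) (cbB * θbB ^ m) δbB) (hθbB0 : 0 ≤ θbB) (hθbB1 : θbB < 1) (hδbB : 0 < δbB) :
    ∃ Ch' θh δh' : ℝ, 0 ≤ Ch' ∧ 0 ≤ θh ∧ θh < 1 ∧ 0 < δh' ∧
      ∀ m : ℕ, LocStencil₂ ((((lin4 (cE₂ * (Lc : ℝ) ^ (2 * (d + 1))) (unitK (sfStep Lc (m + 1)) (smStep d Lc (m + 1)) (coDressKBmAt (toSite r) Lc (KInvStep (d := d) Lc (m + 1)))) Lc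
            (unitS₂ (sfStep Lc (m + 1)) (smStep d Lc (m + 1)) (T2RecAt d Lc (toSite r) cE cVH cΛ cE₂ cB Tc vh₂S (mixFFAt (toSite r) Lc) (m + 1))) -
          lin4 (cE₂ * (Lc : ℝ) ^ (2 * (d + 1))) (unitK (sfStep Lc (m + 1)) (smStep d Lc (m + 1)) (KInvStep (d := d) Lc (m + 1))) Lc
            (unitS₂ (sfStep Lc (m + 1)) (smStep d Lc (m + 1)) (T2RecAt d Lc (toSite r) cE cVH cΛ cE₂ cB Tc vh₂S (mixFFAt (toSite r) Lc) (m + 1)))) +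
        ((fun κ u κ' u' => (cE₂ * (Lc : ℝ) ^ (2 * (d + 1))) • mmRead Lc (K3OfK (unitK (sfStep Lc (m + 1)) (smStep d Lc (m + 1)) (coDressKBmAt (toSite r) Lc (KInvStep (d := d) Lc (m + 1)))) Lc
            (unitS (sfStep Lc (m + 1)) (smStep d Lc (m + 1)) (SpureRecAt d Lc (toSite r) cE cVH cΛ (m + 1))) (unitM (sfStep Lc (m + 1)) (smStep d Lc (m + 1)) (M1At d Lc (toSite r) cΛ (m + 1)))
            (W2SymOfK (unitK (sfStep Lc (m + 1)) (smStep d Lc (m + 1)) (coDressKBmAt (toSite r) Lc (KInvStep (d := d) Lc (m + 1)))) Lc (unitS (sfStep Lc (m + 1)) (smStep d Lc (m + 1)) (SpureRecAt d Lc (toSite r) cE cVH cΛ (m + 1)))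
              (unitM (sfStep Lc (m + 1)) (smStep d Lc (m + 1)) (M1At d Lc (toSite r) cΛ (m + 1))) 0 (unitM₂ (sfStep Lc (m + 1)) (smStep d Lc (m + 1)) (M2Of d Lc (mixFFAt (toSite r) Lc) (m + 1)))) κ u κ' u')
          + cB • vh₂S κ u κ' u') -
         (fun κ u κ' u' => (cE₂ * (Lc : ℝ) ^ (2 * (d + 1))) • mmRead Lc (K3OfK (unitK (sfStep Lc (m + 1)) (smStep d Lc (m + 1)) (KInvStep (d := d) Lc (m + 1))) Lc
            (unitS (sfStep Lc (m + 1)) (smStep d Lc (m + 1)) (SpureRecAt d Lc (toSite r) cE cVH cΛ (m + 1))) (unitM (sfStep Lc (m + 1)) (smStep d Lc (m + 1)) (M1At d Lc (toSite r) cΛ (m + 1)))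
            (W2SymOfK (unitK (sfStep Lc (m + 1)) (smStep d Lc (m + 1)) (KInvStep (d := d) Lc (m + 1))) Lc (unitS (sfStep Lc (m + 1)) (smStep d Lc (m + 1)) (SpureRecAt d Lc (toSite r) cE cVH cΛ (m + 1)))
              (unitM (sfStep Lc (m + 1)) (smStep d Lc (m + 1)) (M1At d Lc (toSite r) cΛ (m + 1))) 0 (unitM₂ (sfStep Lc (m + 1)) (smStep d Lc (m + 1)) (M2Of d Lc (mixFFAt (toSite r) Lc) (m + 1)))) κ u κ' u')
          + cB • vh₂S κ u κ' u')))) -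
        (((lin4 (cE₂ * (Lc : ℝ) ^ (2 * (d + 1))) (unitK (sfStep Lc m) (smStep d Lc m) (coDressKBmAt (toSite r) Lc (KInvStep (d := d) Lc m))) Lc
            (unitS₂ (sfStep Lc m) (smStep d Lc m) (T2RecAt d Lc (toSite r) cE cVH cΛ cE₂ cB Tc vh₂S (mixFFAt (toSite r) Lc) m)) -
          lin4 (cE₂ * (Lc : ℝ) ^ (2 * (d + 1))) (unitK (sfStep Lc m) (smStep d Lc m) (KInvStep (d := d) Lc m)) Lc
            (unitS₂ (sfStep Lc m) (smStep d Lc m) (T2RecAt d Lc (toSite r) cE cVH cΛ cE₂ cB Tc vh₂S (mixFFAt (toSite r) Lc) m))) +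
        ((fun κ u κ' u' => (cE₂ * (Lc : ℝ) ^ (2 * (d + 1))) • mmRead Lc (K3OfK (unitK (sfStep Lc m) (smStep d Lc m) (coDressKBmAt (toSite r) Lc (KInvStep (d := d) Lc m))) Lc
            (unitS (sfStep Lc m) (smStep d Lc m) (SpureRecAt d Lc (toSite r) cE cVH cΛ m)) (unitM (sfStep Lc m) (smStep d Lc m) (M1At d Lc (toSite r) cΛ m))
            (W2SymOfK (unitK (sfStep Lc m) (smStep d Lc m) (coDressKBmAt (toSite r) Lc (KInvStep (d := d) Lc m))) Lc (unitS (sfStep Lc m) (smStep d Lc m) (SpureRecAt d Lc (toSite r) cE cVH cΛ m))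
              (unitM (sfStep Lc m) (smStep d Lc m) (M1At d Lc (toSite r) cΛ m)) 0 (unitM₂ (sfStep Lc m) (smStep d Lc m) (M2Of d Lc (mixFFAt (toSite r) Lc) m))) κ u κ' u')
          + cB • vh₂S κ u κ' u') -
         (fun κ u κ' u' => (cE₂ * (Lc : ℝ) ^ (2 * (d + 1))) • mmRead Lc (K3OfK (unitK (sfStep Lc m) (smStep d Lc m) (KInvStep (d := d) Lc m)) Lc
            (unitS (sfStep Lc m) (smStep d Lc m) (SpureRecAt d Lc (toSite r) cE cVH cΛ m)) (unitM (sfStep Lc m) (smStep d Lc m) (M1At d Lc (toSite r) cΛ m))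
            (W2SymOfK (unitK (sfStep Lc m) (smStep d Lc m) (KInvStep (d := d) Lc m)) Lc (unitS (sfStep Lc m) (smStep d Lc m) (SpureRecAt d Lc (toSite r) cE cVH cΛ m))
              (unitM (sfStep Lc m) (smStep d Lc m) (M1At d Lc (toSite r) cΛ m)) 0 (unitM₂ (sfStep Lc m) (smStep d Lc m) (M2Of d Lc (mixFFAt (toSite r) Lc) m))) κ u κ' u')
          + cB • vh₂S κ u κ' u'))))) (Ch' * θh ^ m) δh' := by
  have hCK : 0 ≤ CK := (hK 0).nonneg (Sum.inl 0)
  have hcK : 0 ≤ cK := by have h := (hKc 0 0).nonneg (Sum.inl 0); simpa using h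
  have hCY : 0 ≤ CY := (hY 0).nonneg
  have hcbE : 0 ≤ cbE := by have h := (hbEr 0).nonneg; simpa using h
  have hcbB : 0 ≤ cbB := by have h := (hbBr 0).nonneg; simpa using h
  -- the identity, level by level
  have e : ∀ m : ℕ, (((lin4 (cE₂ * (Lc : ℝ) ^ (2 * (d + 1))) (unitK (sfStep Lc (m + 1)) (smStep d Lc (m + 1)) (coDressKBmAt (toSite r) Lc (KInvStep (d := d) Lc (m + 1)))) Lc
            (unitS₂ (sfStep Lc (m + 1)) (smStep d Lc (m + 1)) (T2RecAt d Lc (toSite r) cE cVH cΛ cE₂ cB Tc vh₂S (mixFFAt (toSite r) Lc) (m + 1))) -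
          lin4 (cE₂ * (Lc : ℝ) ^ (2 * (d + 1))) (unitK (sfStep Lc (m + 1)) (smStep d Lc (m + 1)) (KInvStep (d := d) Lc (m + 1))) Lc
            (unitS₂ (sfStep Lc (m + 1)) (smStep d Lc (m + 1)) (T2RecAt d Lc (toSite r) cE cVH cΛ cE₂ cB Tc vh₂S (mixFFAt (toSite r) Lc) (m + 1)))) +
        ((fun κ u κ' u' => (cE₂ * (Lc : ℝ) ^ (2 * (d + 1))) • mmRead Lc (K3OfK (unitK (sfStep Lc (m + 1)) (smStep d Lc (m + 1)) (coDressKBmAt (toSite r) Lc (KInvStep (d := d) Lc (m + 1)))) Lc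
            (unitS (sfStep Lc (m + 1)) (smStep d Lc (m + 1)) (SpureRecAt d Lc (toSite r) cE cVH cΛ (m + 1))) (unitM (sfStep Lc (m + 1)) (smStep d Lc (m + 1)) (M1At d Lc (toSite r) cΛ (m + 1)))
            (W2SymOfK (unitK (sfStep Lc (m + 1)) (smStep d Lc (m + 1)) (coDressKBmAt (toSite r) Lc (KInvStep (d := d) Lc (m + 1)))) Lc (unitS (sfStep Lc (m + 1)) (smStep d Lc (m + 1)) (SpureRecAt d Lc (toSite r) cE cVH cΛ (m + 1)))
              (unitM (sfStep Lc (m + 1)) (smStep d Lc (m + 1)) (M1At d Lc (toSite r) cΛ (m + 1))) 0 (unitM₂ (sfStep Lc (m + 1)) (smStep d Lc (m + 1)) (M2Of d Lc (mixFFAt (toSite r) Lc) (m + 1)))) κ u κ' u')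
          + cB • vh₂S κ u κ' u') -
         (fun κ u κ' u' => (cE₂ * (Lc : ℝ) ^ (2 * (d + 1))) • mmRead Lc (K3OfK (unitK (sfStep Lc (m + 1)) (smStep d Lc (m + 1)) (KInvStep (d := d) Lc (m + 1))) Lc
            (unitS (sfStep Lc (m + 1)) (smStep d Lc (m + 1)) (SpureRecAt d Lc (toSite r) cE cVH cΛ (m + 1))) (unitM (sfStep Lc (m + 1)) (smStep d Lc (m + 1)) (M1At d Lc (toSite r) cΛ (m + 1)))
            (W2SymOfK (unitK (sfStep Lc (m + 1)) (smStep d Lc (m + 1)) (KInvStep (d := d) Lc (m + 1))) Lc (unitS (sfStep Lc (m + 1)) (smStep d Lc (m + 1)) (SpureRecAt d Lc (toSite r) cE cVH cΛ (m + 1)))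
              (unitM (sfStep Lc (m + 1)) (smStep d Lc (m + 1)) (M1At d Lc (toSite r) cΛ (m + 1))) 0 (unitM₂ (sfStep Lc (m + 1)) (smStep d Lc (m + 1)) (M2Of d Lc (mixFFAt (toSite r) Lc) (m + 1)))) κ u κ' u')
          + cB • vh₂S κ u κ' u')))) -
        (((lin4 (cE₂ * (Lc : ℝ) ^ (2 * (d + 1))) (unitK (sfStep Lc m) (smStep d Lc m) (coDressKBmAt (toSite r) Lc (KInvStep (d := d) Lc m))) Lc
            (unitS₂ (sfStep Lc m) (smStep d Lc m) (T2RecAt d Lc (toSite r) cE cVH cΛ cE₂ cB Tc vh₂S (mixFFAt (toSite r) Lc) m)) -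
          lin4 (cE₂ * (Lc : ℝ) ^ (2 * (d + 1))) (unitK (sfStep Lc m) (smStep d Lc m) (KInvStep (d := d) Lc m)) Lc
            (unitS₂ (sfStep Lc m) (smStep d Lc m) (T2RecAt d Lc (toSite r) cE cVH cΛ cE₂ cB Tc vh₂S (mixFFAt (toSite r) Lc) m))) +
        ((fun κ u κ' u' => (cE₂ * (Lc : ℝ) ^ (2 * (d + 1))) • mmRead Lc (K3OfK (unitK (sfStep Lc m) (smStep d Lc m) (coDressKBmAt (toSite r) Lc (KInvStep (d := d) Lc m))) Lc
            (unitS (sfStep Lc m) (smStep d Lc m) (SpureRecAt d Lc (toSite r) cE cVH cΛ m)) (unitM (sfStep Lc m) (smStep d Lc m) (M1At d Lc (toSite r) cΛ m))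
            (W2SymOfK (unitK (sfStep Lc m) (smStep d Lc m) (coDressKBmAt (toSite r) Lc (KInvStep (d := d) Lc m))) Lc (unitS (sfStep Lc m) (smStep d Lc m) (SpureRecAt d Lc (toSite r) cE cVH cΛ m))
              (unitM (sfStep Lc m) (smStep d Lc m) (M1At d Lc (toSite r) cΛ m)) 0 (unitM₂ (sfStep Lc m) (smStep d Lc m) (M2Of d Lc (mixFFAt (toSite r) Lc) m))) κ u κ' u')
          + cB • vh₂S κ u κ' u') -
         (fun κ u κ' u' => (cE₂ * (Lc : ℝ) ^ (2 * (d + 1))) • mmRead Lc (K3OfK (unitK (sfStep Lc m) (smStep d Lc m) (KInvStep (d := d) Lc m)) Lc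
            (unitS (sfStep Lc m) (smStep d Lc m) (SpureRecAt d Lc (toSite r) cE cVH cΛ m)) (unitM (sfStep Lc m) (smStep d Lc m) (M1At d Lc (toSite r) cΛ m))
            (W2SymOfK (unitK (sfStep Lc m) (smStep d Lc m) (KInvStep (d := d) Lc m)) Lc (unitS (sfStep Lc m) (smStep d Lc m) (SpureRecAt d Lc (toSite r) cE cVH cΛ m))
              (unitM (sfStep Lc m) (smStep d Lc m) (M1At d Lc (toSite r) cΛ m)) 0 (unitM₂ (sfStep Lc m) (smStep d Lc m) (M2Of d Lc (mixFFAt (toSite r) Lc) m))) κ u κ' u')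
          + cB • vh₂S κ u κ' u')))) =
      ((lin4 (cE₂ * (Lc : ℝ) ^ (2 * (d + 1))) (unitK (sfStep Lc (m + 1)) (smStep d Lc (m + 1)) (KInvStep (d := d) Lc (m + 1))) Lc ((fun κ u κ' u' => dressKBmAt (toSite r) Lc (coProjBmAtK (toSite r) Lc (fun κ₁ u₁ => coProjBmAtK (toSite r) Lc
            ((unitS₂ (sfStep Lc (m + 1)) (smStep d Lc (m + 1)) (T2RecAt d Lc (toSite r) cE cVH cΛ cE₂ cB Tc vh₂S (mixFFAt (toSite r) Lc) (m + 1))) κ₁ u₁) κ' u') κ u)) -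
          (unitS₂ (sfStep Lc (m + 1)) (smStep d Lc (m + 1)) (T2RecAt d Lc (toSite r) cE cVH cΛ cE₂ cB Tc vh₂S (mixFFAt (toSite r) Lc) (m + 1)))) -
          lin4 (cE₂ * (Lc : ℝ) ^ (2 * (d + 1))) (unitK (sfStep Lc m) (smStep d Lc m) (KInvStep (d := d) Lc m)) Lc ((fun κ u κ' u' => dressKBmAt (toSite r) Lc (coProjBmAtK (toSite r) Lc (fun κ₁ u₁ => coProjBmAtK (toSite r) Lc
            ((unitS₂ (sfStep Lc (m + 1)) (smStep d Lc (m + 1)) (T2RecAt d Lc (toSite r) cE cVH cΛ cE₂ cB Tc vh₂S (mixFFAt (toSite r) Lc) (m + 1))) κ₁ u₁) κ' u') κ u)) -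
          (unitS₂ (sfStep Lc (m + 1)) (smStep d Lc (m + 1)) (T2RecAt d Lc (toSite r) cE cVH cΛ cE₂ cB Tc vh₂S (mixFFAt (toSite r) Lc) (m + 1))))) +
        lin4 (cE₂ * (Lc : ℝ) ^ (2 * (d + 1))) (unitK (sfStep Lc m) (smStep d Lc m) (KInvStep (d := d) Lc m)) Lc (((fun κ u κ' u' => dressKBmAt (toSite r) Lc (coProjBmAtK (toSite r) Lc (fun κ₁ u₁ => coProjBmAtK (toSite r) Lc
            ((unitS₂ (sfStep Lc (m + 1)) (smStep d Lc (m + 1)) (T2RecAt d Lc (toSite r) cE cVH cΛ cE₂ cB Tc vh₂S (mixFFAt (toSite r) Lc) (m + 1))) κ₁ u₁) κ' u') κ u)) -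
          (unitS₂ (sfStep Lc (m + 1)) (smStep d Lc (m + 1)) (T2RecAt d Lc (toSite r) cE cVH cΛ cE₂ cB Tc vh₂S (mixFFAt (toSite r) Lc) (m + 1)))) -
          ((fun κ u κ' u' => dressKBmAt (toSite r) Lc (coProjBmAtK (toSite r) Lc (fun κ₁ u₁ => coProjBmAtK (toSite r) Lc
            ((unitS₂ (sfStep Lc m) (smStep d Lc m) (T2RecAt d Lc (toSite r) cE cVH cΛ cE₂ cB Tc vh₂S (mixFFAt (toSite r) Lc) m)) κ₁ u₁) κ' u') κ u)) -
          (unitS₂ (sfStep Lc m) (smStep d Lc m) (T2RecAt d Lc (toSite r) cE cVH cΛ cE₂ cB Tc vh₂S (mixFFAt (toSite r) Lc) m))))) +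
      (((fun κ u κ' u' => (cE₂ * (Lc : ℝ) ^ (2 * (d + 1))) • mmRead Lc (K3OfK (unitK (sfStep Lc (m + 1)) (smStep d Lc (m + 1)) (coDressKBmAt (toSite r) Lc (KInvStep (d := d) Lc (m + 1)))) Lc
            (unitS (sfStep Lc (m + 1)) (smStep d Lc (m + 1)) (SpureRecAt d Lc (toSite r) cE cVH cΛ (m + 1))) (unitM (sfStep Lc (m + 1)) (smStep d Lc (m + 1)) (M1At d Lc (toSite r) cΛ (m + 1)))
            (W2SymOfK (unitK (sfStep Lc (m + 1)) (smStep d Lc (m + 1)) (coDressKBmAt (toSite r) Lc (KInvStep (d := d) Lc (m + 1)))) Lc (unitS (sfStep Lc (m + 1)) (smStep d Lc (m + 1)) (SpureRecAt d Lc (toSite r) cE cVH cΛ (m + 1)))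
              (unitM (sfStep Lc (m + 1)) (smStep d Lc (m + 1)) (M1At d Lc (toSite r) cΛ (m + 1))) 0 (unitM₂ (sfStep Lc (m + 1)) (smStep d Lc (m + 1)) (M2Of d Lc (mixFFAt (toSite r) Lc) (m + 1)))) κ u κ' u')
          + cB • vh₂S κ u κ' u') -
          (fun κ u κ' u' => (cE₂ * (Lc : ℝ) ^ (2 * (d + 1))) • mmRead Lc (K3OfK (unitK (sfStep Lc m) (smStep d Lc m) (coDressKBmAt (toSite r) Lc (KInvStep (d := d) Lc m))) Lc
            (unitS (sfStep Lc m) (smStep d Lc m) (SpureRecAt d Lc (toSite r) cE cVH cΛ m)) (unitM (sfStep Lc m) (smStep d Lc m) (M1At d Lc (toSite r) cΛ m))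
            (W2SymOfK (unitK (sfStep Lc m) (smStep d Lc m) (coDressKBmAt (toSite r) Lc (KInvStep (d := d) Lc m))) Lc (unitS (sfStep Lc m) (smStep d Lc m) (SpureRecAt d Lc (toSite r) cE cVH cΛ m))
              (unitM (sfStep Lc m) (smStep d Lc m) (M1At d Lc (toSite r) cΛ m)) 0 (unitM₂ (sfStep Lc m) (smStep d Lc m) (M2Of d Lc (mixFFAt (toSite r) Lc) m))) κ u κ' u')
          + cB • vh₂S κ u κ' u')) -
        ((fun κ u κ' u' => (cE₂ * (Lc : ℝ) ^ (2 * (d + 1))) • mmRead Lc (K3OfK (unitK (sfStep Lc (m + 1)) (smStep d Lc (m + 1)) (KInvStep (d := d) Lc (m + 1))) Lc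
            (unitS (sfStep Lc (m + 1)) (smStep d Lc (m + 1)) (SpureRecAt d Lc (toSite r) cE cVH cΛ (m + 1))) (unitM (sfStep Lc (m + 1)) (smStep d Lc (m + 1)) (M1At d Lc (toSite r) cΛ (m + 1)))
            (W2SymOfK (unitK (sfStep Lc (m + 1)) (smStep d Lc (m + 1)) (KInvStep (d := d) Lc (m + 1))) Lc (unitS (sfStep Lc (m + 1)) (smStep d Lc (m + 1)) (SpureRecAt d Lc (toSite r) cE cVH cΛ (m + 1)))
              (unitM (sfStep Lc (m + 1)) (smStep d Lc (m + 1)) (M1At d Lc (toSite r) cΛ (m + 1))) 0 (unitM₂ (sfStep Lc (m + 1)) (smStep d Lc (m + 1)) (M2Of d Lc (mixFFAt (toSite r) Lc) (m + 1)))) κ u κ' u')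
          + cB • vh₂S κ u κ' u') -
          (fun κ u κ' u' => (cE₂ * (Lc : ℝ) ^ (2 * (d + 1))) • mmRead Lc (K3OfK (unitK (sfStep Lc m) (smStep d Lc m) (KInvStep (d := d) Lc m)) Lc
            (unitS (sfStep Lc m) (smStep d Lc m) (SpureRecAt d Lc (toSite r) cE cVH cΛ m)) (unitM (sfStep Lc m) (smStep d Lc m) (M1At d Lc (toSite r) cΛ m))
            (W2SymOfK (unitK (sfStep Lc m) (smStep d Lc m) (KInvStep (d := d) Lc m)) Lc (unitS (sfStep Lc m) (smStep d Lc m) (SpureRecAt d Lc (toSite r) cE cVH cΛ m))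
              (unitM (sfStep Lc m) (smStep d Lc m) (M1At d Lc (toSite r) cΛ m)) 0 (unitM₂ (sfStep Lc m) (smStep d Lc m) (M2Of d Lc (mixFFAt (toSite r) Lc) m))) κ u κ' u')
          + cB • vh₂S κ u κ' u'))) := fun m => by
    rw [h_comb_eq_lin4_defect_add hLc hr cE cVH cΛ cE₂ cB Tc hB (m + 1), h_comb_eq_lin4_defect_add hLc hr cE cVH cΛ cE₂ cB Tc hB m,
      lin4_sub (hK m) hδK (cE₂ * (Lc : ℝ) ^ (2 * (d + 1))) Lc (fun κ u κ' u' x z a b => sup_of_locStencil₂ hδY.le (hY (m + 1)) κ u κ' u' x z a b)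
        (fun κ u κ' u' x z a b => sup_of_locStencil₂ hδY.le (hY m) κ u κ' u' x z a b)]
    abel
  -- term 1: the transport DIFFERENCE on the next defect (leaf-03's `lin_cauchy`)
  obtain ⟨m₀, hm₀_def⟩ : ∃ m₀ : ℝ, m₀ = min δK δY := ⟨_, rfl⟩
  have hm₀ : 0 < m₀ := by rw [hm₀_def]; exact lt_min hδK hδY
  have hK1 : ∀ j, Decays (unitK (sfStep Lc j) (smStep d Lc j) (KInvStep (d := d) Lc j)) CK m₀ :=
    fun j => decays_mono (hK j) hCK le_rfl (by rw [hm₀_def]; exact min_le_left _ _)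
  have hKc1 : ∀ k j, Decays ((unitK (sfStep Lc (k + j)) (smStep d Lc (k + j)) (KInvStep (d := d) Lc (k + j))) - (unitK (sfStep Lc k) (smStep d Lc k) (KInvStep (d := d) Lc k))) (cK * θK ^ k) m₀ :=
    fun k j => decays_mono (hKc k j) (by positivity) le_rfl (by rw [hm₀_def]; exact min_le_left _ _)
  have hY₀ : ∀ m, LocStencil₂ ((fun κ u κ' u' => dressKBmAt (toSite r) Lc (coProjBmAtK (toSite r) Lc (fun κ₁ u₁ => coProjBmAtK (toSite r) Lc
            ((unitS₂ (sfStep Lc m) (smStep d Lc m) (T2RecAt d Lc (toSite r) cE cVH cΛ cE₂ cB Tc vh₂S (mixFFAt (toSite r) Lc) m)) κ₁ u₁) κ' u') κ u)) -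
          (unitS₂ (sfStep Lc m) (smStep d Lc m) (T2RecAt d Lc (toSite r) cE cVH cΛ cE₂ cB Tc vh₂S (mixFFAt (toSite r) Lc) m))) CY m₀ := fun m => (hY m).mono (by rw [hm₀_def]; exact min_le_right _ _)
  obtain ⟨L₁, hL₁_def⟩ : ∃ L₁ : ℝ, L₁ = |(cE₂ * (Lc : ℝ) ^ (2 * (d + 1)))| * lSand d CK (cBi d CK CY m₀) cK (lBi d CK CY cK 0 m₀) (m₀ / 32) := ⟨_, rfl⟩
  have h1 : ∀ m : ℕ, LocStencil₂ (lin4 (cE₂ * (Lc : ℝ) ^ (2 * (d + 1))) (unitK (sfStep Lc (m + 1)) (smStep d Lc (m + 1)) (KInvStep (d := d) Lc (m + 1))) Lc ((fun κ u κ' u' => dressKBmAt (toSite r) Lc (coProjBmAtK (toSite r) Lc (fun κ₁ u₁ => coProjBmAtK (toSite r) Lc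
            ((unitS₂ (sfStep Lc (m + 1)) (smStep d Lc (m + 1)) (T2RecAt d Lc (toSite r) cE cVH cΛ cE₂ cB Tc vh₂S (mixFFAt (toSite r) Lc) (m + 1))) κ₁ u₁) κ' u') κ u)) -
          (unitS₂ (sfStep Lc (m + 1)) (smStep d Lc (m + 1)) (T2RecAt d Lc (toSite r) cE cVH cΛ cE₂ cB Tc vh₂S (mixFFAt (toSite r) Lc) (m + 1)))) -
          lin4 (cE₂ * (Lc : ℝ) ^ (2 * (d + 1))) (unitK (sfStep Lc m) (smStep d Lc m) (KInvStep (d := d) Lc m)) Lc ((fun κ u κ' u' => dressKBmAt (toSite r) Lc (coProjBmAtK (toSite r) Lc (fun κ₁ u₁ => coProjBmAtK (toSite r) Lc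
            ((unitS₂ (sfStep Lc (m + 1)) (smStep d Lc (m + 1)) (T2RecAt d Lc (toSite r) cE cVH cΛ cE₂ cB Tc vh₂S (mixFFAt (toSite r) Lc) (m + 1))) κ₁ u₁) κ' u') κ u)) -
          (unitS₂ (sfStep Lc (m + 1)) (smStep d Lc (m + 1)) (T2RecAt d Lc (toSite r) cE cVH cΛ cE₂ cB Tc vh₂S (mixFFAt (toSite r) Lc) (m + 1))))) (L₁ * θK ^ m) (m₀ / 128) := fun m => by
    rw [hL₁_def]
    exact lin_cauchy (Lc := Lc) (K := fun j => (unitK (sfStep Lc j) (smStep d Lc j) (KInvStep (d := d) Lc j))) hLc hm₀ hK1 hKc1 (hY₀ (m + 1)) (cE₂ * (Lc : ℝ) ^ (2 * (d + 1))) m 1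
  have hL₁ : 0 ≤ L₁ := by have h := (h1 0).nonneg; simpa using h
  -- term 2: one undressed step of the defect's rate row
  obtain ⟨L₂, hL₂, h2⟩ := exists_lin4_rate hLc (cE₂ * (Lc : ℝ) ^ (2 * (d + 1)))
    (fun m => ((fun κ u κ' u' => dressKBmAt (toSite r) Lc (coProjBmAtK (toSite r) Lc (fun κ₁ u₁ => coProjBmAtK (toSite r) Lc
            ((unitS₂ (sfStep Lc (m + 1)) (smStep d Lc (m + 1)) (T2RecAt d Lc (toSite r) cE cVH cΛ cE₂ cB Tc vh₂S (mixFFAt (toSite r) Lc) (m + 1))) κ₁ u₁) κ' u') κ u)) -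
          (unitS₂ (sfStep Lc (m + 1)) (smStep d Lc (m + 1)) (T2RecAt d Lc (toSite r) cE cVH cΛ cE₂ cB Tc vh₂S (mixFFAt (toSite r) Lc) (m + 1)))) -
          ((fun κ u κ' u' => dressKBmAt (toSite r) Lc (coProjBmAtK (toSite r) Lc (fun κ₁ u₁ => coProjBmAtK (toSite r) Lc
            ((unitS₂ (sfStep Lc m) (smStep d Lc m) (T2RecAt d Lc (toSite r) cE cVH cΛ cE₂ cB Tc vh₂S (mixFFAt (toSite r) Lc) m)) κ₁ u₁) κ' u') κ u)) -
          (unitS₂ (sfStep Lc m) (smStep d Lc m) (T2RecAt d Lc (toSite r) cE cVH cΛ cE₂ cB Tc vh₂S (mixFFAt (toSite r) Lc) m)))) hK hδK hYr hδY'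
  refine ⟨(L₁ + L₂) + (cbE + cbB), max (max θK θY) (max θbE θbB), min (min (m₀ / 128) (min δK δY' / 128)) (min δbE δbB), by positivity,
    (hθK0.trans (le_max_left _ _)).trans (le_max_left _ _), max_lt (max_lt hθK1 hθY1) (max_lt hθbE1 hθbB1),
    lt_min (lt_min (by positivity) (by positivity)) (lt_min hδbE hδbB), fun m => ?_⟩
  rw [e m]
  exact locStencil₂_add_rate (locStencil₂_add_rate (h1 m) (h2 m) hL₁ hL₂ hθK0 hθY0) (locStencil₂_sub_rate (hbEr m) (hbBr m) hcbE hcbB hθbE0 hθbB0)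
    (add_nonneg hL₁ hL₂) (add_nonneg hcbE hcbB) (le_max_of_le_left hθK0) (le_max_of_le_left hθbE0)

end Generic

end Summit.QuantumFields.BalabanUV.Beta.GAN24.T2DevConservationDefectRows

end
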